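import Summits.QuantumFields.BalabanUV.T4Continuum.Support.ShellMeasureAverageLocality148
import Summits.QuantumFields.BalabanUV.T4Continuum.Support.AveragingDeficitPeriodicCounting
import HarnessLib

/-!
# T⁴ programme, node NE3 — census R26′, step 1: THE ONE-STEP REMAINDER OF BAŁABAN's COVARIANT AVERAGE IN ℓ¹ AND ℓ² AGAINST THE FIELD's ℓ²-MASS
# (`Σ_c ‖C(V₀, A, c)‖ ≤ C₁L²·d(4L+1)^d·Σ_b‖A_b‖²`, `Σ_c ‖C(V₀, A, c)‖² ≤ (C₁L²)²·a²·d(4L+1)^d·Σ_b‖A_b‖²` on the torus) — the input that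
# replaces the Π-REG majorant at d = 4

Cell `pub-balaban-gaps` (YM blitz, track G2, seat `ne3`, unit `pub-balaban-gaps-ne3`; writer prover-pub-balaban-gaps-ne3-g4-0, 2026-08-23), census
`run/shared/lean/pub/pub-balaban-gaps/ne/NE3.md` §4 R26′ ∕ §10 F8.  WHY.  The `sfClass` END on B8's surface (`PairLandauB8EndSfClassB8`) displays ONE non-printed
input: the Π-REG majorant `LocalSupMajorant L N (j+1) Z m Ĉ` (finding F6), used only to turn the LOCAL sup² letter of the k-fold remainder
`‖φ(c)‖ ≤ C₂(L^{j+1}·sup_{block pair}‖Z‖)²` into the ℓ²∕ℓ¹ sizes of `φ = QbarIter L (j+1) W Z` against `dirSq Z`.  Finding F8 (gen 4): at `d = 4` those sizes follow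
WITHOUT any regularity of `Z` from the ℓ² TOWER of one-step remainders — `A_k = Lin_{k←0}A_0 + Σ_{i<k} Lin_{k←i+1} C_i(A_i)`, `A_k = 0` by (1.37),
`‖Lin_m‖_{ℓ²→ℓ²} ≤ 2(L^{1−d∕2})^m` (`NE3FramePotBoundWClass.l2sq_QbarIter_le_class`), `sup‖A_i‖ ≤ 2L^i·sup‖A_0‖` ([B7] Prop. 4, `B7Eq123General.prop4_general`) — ONCE the
one-step remainder is bounded in ℓ² (and, for the ℓ¹-curl letter, in ℓ¹) against the field's ℓ²-mass.  THIS FILE proves exactly that one-step input, from the tree's LOCAL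
form of [B7] Prop. 3 (123) (`ShellMeasureAverageLocality148.Ccov_eq_ins` + `norm_Ccov_insCfg_le`: `‖C(V₀, A, c)‖ ≤ C₁L²·(sup_{b ⊂ B(c₋)∪B(c₊)}‖A_b‖)²`), the
elementary `sup² ≤ Σ‖·‖²` on the block pair, and the torus block count `AveragingDeficitPeriodicCounting.sum_periodBox_box_le`.

CONTENT (all [folklore]; 0 sorry; 0 def): `pi_norm_sq_le_sum_sq` (`‖a‖² ≤ Σ_s‖a s‖²` for the sup norm on `S → 𝔸`), `sum_S1_le_box` (the block pair of the `L`-bond at `L•z`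
lies in `box (2L) (L•z)`), `norm_Ccov_le_local_sq` (the local sup² letter at one step), **`sum_norm_Ccov_le`** (ℓ¹, quadratic in the field — NO sup factor) and
**`sum_normSq_Ccov_le`** (ℓ², one sup factor) over the coarse period box `periodBox N₁` against `Σ_{x∈periodBox (L·N₁)} Σ_μ ‖A x μ‖²`.

HONEST FRAMING.  One-step kinematics of [Balaban1985Averaging] Prop. 3 on OUR objects at a general unit-bounded background with `pdev V₀ < β ≤ 1∕(1024(d+1)(d+4)L²)`;
the TOWER (R26′ steps 2–4: telescoping, ℓ² propagation, the supplier re-wired without Π-REG) is NOT in this file; NOTHING of Bałaban's is proved beyond this printed-type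
one-step letter's consequences; **NE3 is NOT proved**; spine PROVED 0∕9; finite T⁴ rung (B)+1 — NOT continuum YM on ℝ⁴, NOT infinite volume, NOT mass gap, NOT `BetaPertH`,
NOT Clay.  PLACEMENT: `Summits/QuantumFields/BalabanUV/T4Continuum/Spine/NE3/`; imports accepted modules only.
-/

noncomputable section

open scoped BigOperators
open NormedSpace Finset Metric

namespace Summit.QuantumFields.BalabanUV.T4Continuum.NE3.RemainderSumsStepB8

open Literature.MathematicalPhysics.QuantumFieldTheory.Balaban1983to89
open B7Prop1Explicit (Site e U1)
open B7Prop2Explicit (pdev)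
open B7Prop3Flat (insCfg c3 c3_pos)
open B7Prop1Local (InBox bondHi)
open B7Prop3GeneralLinear (Ccov)
open B7Prop5Flat (BondIn bondsIn mem_bondsIn restr S1)
open T4AveragingDeficitWall (box)
open T4AveragingDeficitWallBoundary (periodBox)
open AveragingDeficitPeriodicCounting (sum_periodBox_box_le)
open ShellMeasureAverageProp4General (C1cov C1cov_pos)
open ShellMeasureAverageLocality148 (Ccov_eq_ins norm_Ccov_insCfg_le)

variable {d : ℕ}

/-! ## §1 Two elementary facts -/

/-- For the sup norm on a finite product, `‖a‖² ≤ Σ_s ‖a s‖²`. [folklore] -/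
theorem pi_norm_sq_le_sum_sq {ι : Type*} [Fintype ι] {E : Type*} [SeminormedAddCommGroup E] (a : ι → E) :
    ‖a‖ ^ 2 ≤ ∑ s, ‖a s‖ ^ 2 := by
  have h0 : 0 ≤ ∑ s, ‖a s‖ ^ 2 := Finset.sum_nonneg fun s _ => sq_nonneg _
  have h1 : ‖a‖ ≤ Real.sqrt (∑ s, ‖a s‖ ^ 2) := by
    refine (pi_norm_le_iff_of_nonneg (Real.sqrt_nonneg _)).2 fun s => ?_
    exact (Real.le_sqrt (norm_nonneg _) h0).2
      (Finset.single_le_sum (f := fun t => ‖a t‖ ^ 2) (fun t _ => sq_nonneg _) (Finset.mem_univ s))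
  calc ‖a‖ ^ 2 ≤ (Real.sqrt (∑ s, ‖a s‖ ^ 2)) ^ 2 := pow_le_pow_left₀ (norm_nonneg _) h1 2
    _ = ∑ s, ‖a s‖ ^ 2 := Real.sq_sqrt h0

variable {𝔸 : Type*} [NormedRing 𝔸] [NormedAlgebra ℂ 𝔸] [CompleteSpace 𝔸] [NormOneClass 𝔸]

omit [NormedAlgebra ℂ 𝔸] [CompleteSpace 𝔸] [NormOneClass 𝔸] in
/-- The squared ℓ²-mass of a field on the block pair `S1 L (L•z) κ` of the `L`-bond at `L•z` is at most its squared ℓ²-mass on the cube `box (2L) (L•z)`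
(the pair lies in that cube). [folklore] -/
theorem sum_S1_le_box {L : ℕ} (A : Site d → Fin d → 𝔸) (z : Site d) (κ : Fin d) :
    ∑ s ∈ S1 L ((L : ℤ) • z) κ, ‖A s.1 s.2‖ ^ 2 ≤ ∑ x ∈ box (2 * L) ((L : ℤ) • z), ∑ μ : Fin d, ‖A x μ‖ ^ 2 := by
  rw [← Finset.sum_product (s := box (2 * L) ((L : ℤ) • z)) (t := (Finset.univ : Finset (Fin d))) (f := fun s => ‖A s.1 s.2‖ ^ 2)]
  refine Finset.sum_le_sum_of_subset_of_nonneg ?_ (fun s _ _ => sq_nonneg _)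
  intro s hs
  have hb := (mem_bondsIn.1 hs).1
  refine Finset.mem_product.2 ⟨?_, Finset.mem_univ _⟩
  rw [T4AveragingDeficitWall.box, Finset.mem_Icc]
  constructor
  · intro i
    have h := (hb i).1
    simp only [Pi.sub_apply, Pi.smul_apply, smul_eq_mul] at h ⊢
    have hL0 : (0 : ℤ) ≤ ((2 * L : ℕ) : ℤ) := by positivity
    linarith
  · intro i
    have h := (hb i).2
    simp only [bondHi, Pi.add_apply, Pi.smul_apply, smul_eq_mul] at h ⊢
    have hL2 : ((2 * L : ℕ) : ℤ) = 2 * (L : ℤ) := by push_cast; ring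
    rw [hL2]
    split_ifs at h <;> linarith

omit [NormedAlgebra ℂ 𝔸] [CompleteSpace 𝔸] [NormOneClass 𝔸] in
/-- The squared SUP of a field over the block pair is at most its squared ℓ²-mass on the cube `box (2L) (L•z)`. [folklore] -/
theorem norm_restr_sq_le_box {L : ℕ} (A : Site d → Fin d → 𝔸) (z : Site d) (κ : Fin d) :
    ‖restr (S1 L ((L : ℤ) • z) κ) A‖ ^ 2 ≤ ∑ x ∈ box (2 * L) ((L : ℤ) • z), ∑ μ : Fin d, ‖A x μ‖ ^ 2 := by
  refine (pi_norm_sq_le_sum_sq _).trans ?_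
  have e : ∑ s : ↥(S1 L ((L : ℤ) • z) κ), ‖restr (S1 L ((L : ℤ) • z) κ) A s‖ ^ 2
      = ∑ s ∈ S1 L ((L : ℤ) • z) κ, ‖A s.1 s.2‖ ^ 2 :=
    Finset.sum_coe_sort (S1 L ((L : ℤ) • z) κ) (fun s => ‖A s.1 s.2‖ ^ 2)
  rw [e]
  exact sum_S1_le_box A z κ

/-! ## §2 The one-step remainder: local sup² letter, then ℓ¹ and ℓ² on the torus -/

section Step

variable {L : ℕ} (hL : 1 ≤ L) {V₀ : Site d → Fin d → 𝔸ˣ} (hV₀ : ∀ x κ, V₀ x κ ∈ U1 𝔸) {β : ℝ} (hβ0 : 0 ≤ β)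
  (hβ : pdev V₀ < β) (hβmax : β ≤ 1 / (1024 * ((d : ℝ) + 1) * ((d : ℝ) + 4) * (L : ℝ) ^ 2))
include hL hV₀ hβ0 hβ hβmax

/-- **THE LOCAL sup² LETTER OF THE ONE-STEP REMAINDER** ([B7] Prop. 3 (123) read on the block pair): for a field with `‖A_b‖ ≤ a ≤ c₃∕2` everywhere,
`‖C(V₀, A, c)‖ ≤ C₁L²·‖A|_{S1(c)}‖²` with `‖A|_{S1(c)}‖` the SUP over the bonds of `B(c₋) ∪ B(c₊)` (`Ccov_eq_ins` + `norm_Ccov_insCfg_le`). [folklore] -/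
theorem norm_Ccov_le_local_sq (A : Site d → Fin d → 𝔸) {a : ℝ} (ha0 : 0 ≤ a) (hA : ∀ x μ, ‖A x μ‖ ≤ a) (hac : a ≤ c3 d L / 2)
    (q : Site d) (κ : Fin d) :
    ‖Ccov L V₀ A q κ‖ ≤ C1cov d * (L : ℝ) ^ 2 * ‖restr (S1 L q κ) A‖ ^ 2 := by
  have hnA : ‖restr (S1 L q κ) A‖ ≤ a := (pi_norm_le_iff_of_nonneg ha0).2 fun s => hA _ _
  rw [Ccov_eq_ins L hL V₀ A q κ]
  exact norm_Ccov_insCfg_le hL hV₀ hβ0 hβ hβmax (S1 L q κ) q κ (hnA.trans hac)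

/-- **THE ONE-STEP REMAINDER IN ℓ¹ ON THE TORUS IS QUADRATIC IN THE FIELD's ℓ²-MASS — NO SUP FACTOR, NO REGULARITY OF THE FIELD**: for `N₁ ≥ 1`, an
`(L·N₁)`-periodic field with `‖A_b‖ ≤ a ≤ c₃∕2`: `Σ_{z∈periodBox N₁} Σ_κ ‖C(V₀, A, ⟨L•z, κ⟩)‖ ≤ C₁L²·d·(4L+1)^d·Σ_{x∈periodBox (L·N₁)} Σ_μ ‖A x μ‖²`. [folklore] -/
theorem sum_norm_Ccov_le {N₁ : ℕ} (hN₁ : 1 ≤ N₁) (A : Site d → Fin d → 𝔸) {a : ℝ} (ha0 : 0 ≤ a) (hA : ∀ x μ, ‖A x μ‖ ≤ a)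
    (hac : a ≤ c3 d L / 2) (hAP : ∀ (x : Site d) (κ μ : Fin d), A (x + ((L * N₁ : ℕ) : ℤ) • e κ) μ = A x μ) :
    ∑ z ∈ periodBox (d := d) N₁, ∑ κ : Fin d, ‖Ccov L V₀ A ((L : ℤ) • z) κ‖
      ≤ C1cov d * (L : ℝ) ^ 2 * (d * (2 * (2 * L) + 1) ^ d) * ∑ x ∈ periodBox (d := d) (L * N₁), ∑ μ : Fin d, ‖A x μ‖ ^ 2 := by
  have hC0 : 0 ≤ C1cov d * (L : ℝ) ^ 2 := by have := C1cov_pos d; positivity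
  set g : Site d → ℝ := fun x => ∑ μ : Fin d, ‖A x μ‖ ^ 2 with hg
  have hg0 : ∀ x, 0 ≤ g x := fun x => Finset.sum_nonneg fun μ _ => sq_nonneg _
  have hgP : ∀ (x : Site d) (κ : Fin d), g (x + ((L * N₁ : ℕ) : ℤ) • e κ) = g x := by
    intro x κ; simp only [hg, hAP]
  -- per coarse bond
  have hpt : ∀ (z : Site d) (κ : Fin d), ‖Ccov L V₀ A ((L : ℤ) • z) κ‖ ≤ C1cov d * (L : ℝ) ^ 2 * ∑ x ∈ box (2 * L) ((L : ℤ) • z), g x := by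
    intro z κ
    exact (norm_Ccov_le_local_sq hL hV₀ hβ0 hβ hβmax A ha0 hA hac _ κ).trans
      (mul_le_mul_of_nonneg_left (norm_restr_sq_le_box A z κ) hC0)
  have hbox := sum_periodBox_box_le L N₁ hL hN₁ (2 * L) hg0 hgP
  calc ∑ z ∈ periodBox (d := d) N₁, ∑ κ : Fin d, ‖Ccov L V₀ A ((L : ℤ) • z) κ‖
      ≤ ∑ z ∈ periodBox (d := d) N₁, ∑ _κ : Fin d, C1cov d * (L : ℝ) ^ 2 * ∑ x ∈ box (2 * L) ((L : ℤ) • z), g x :=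
        Finset.sum_le_sum fun z _ => Finset.sum_le_sum fun κ _ => hpt z κ
    _ = C1cov d * (L : ℝ) ^ 2 * (d * ∑ z ∈ periodBox (d := d) N₁, ∑ x ∈ box (2 * L) ((L : ℤ) • z), g x) := by
        rw [Finset.mul_sum, Finset.mul_sum]
        refine Finset.sum_congr rfl fun z _ => ?_
        rw [Finset.sum_const, Finset.card_univ, Fintype.card_fin, nsmul_eq_mul]
        ring
    _ ≤ C1cov d * (L : ℝ) ^ 2 * (d * ((2 * (2 * L) + 1) ^ d * ∑ x ∈ periodBox (d := d) (L * N₁), g x)) := by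
        refine mul_le_mul_of_nonneg_left (mul_le_mul_of_nonneg_left ?_ (by positivity)) hC0
        exact_mod_cast hbox
    _ = C1cov d * (L : ℝ) ^ 2 * (d * (2 * (2 * L) + 1) ^ d) * ∑ x ∈ periodBox (d := d) (L * N₁), g x := by
        ring

/-- **THE ONE-STEP REMAINDER IN ℓ² ON THE TORUS: ONE SUP FACTOR TIMES THE FIELD's ℓ²-MASS**: under the same hypotheses,
`Σ_{z∈periodBox N₁} Σ_κ ‖C(V₀, A, ⟨L•z, κ⟩)‖² ≤ (C₁L²)²·a²·d·(4L+1)^d·Σ_{x∈periodBox (L·N₁)} Σ_μ ‖A x μ‖²`. [folklore] -/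
theorem sum_normSq_Ccov_le {N₁ : ℕ} (hN₁ : 1 ≤ N₁) (A : Site d → Fin d → 𝔸) {a : ℝ} (ha0 : 0 ≤ a) (hA : ∀ x μ, ‖A x μ‖ ≤ a)
    (hac : a ≤ c3 d L / 2) (hAP : ∀ (x : Site d) (κ μ : Fin d), A (x + ((L * N₁ : ℕ) : ℤ) • e κ) μ = A x μ) :
    ∑ z ∈ periodBox (d := d) N₁, ∑ κ : Fin d, ‖Ccov L V₀ A ((L : ℤ) • z) κ‖ ^ 2
      ≤ (C1cov d * (L : ℝ) ^ 2) ^ 2 * a ^ 2 * (d * (2 * (2 * L) + 1) ^ d)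
          * ∑ x ∈ periodBox (d := d) (L * N₁), ∑ μ : Fin d, ‖A x μ‖ ^ 2 := by
  have hC0 : 0 ≤ C1cov d * (L : ℝ) ^ 2 := by have := C1cov_pos d; positivity
  set g : Site d → ℝ := fun x => ∑ μ : Fin d, ‖A x μ‖ ^ 2 with hg
  have hg0 : ∀ x, 0 ≤ g x := fun x => Finset.sum_nonneg fun μ _ => sq_nonneg _
  have hgP : ∀ (x : Site d) (κ : Fin d), g (x + ((L * N₁ : ℕ) : ℤ) • e κ) = g x := by
    intro x κ; simp only [hg, hAP]
  have hpt : ∀ (z : Site d) (κ : Fin d),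
      ‖Ccov L V₀ A ((L : ℤ) • z) κ‖ ^ 2 ≤ (C1cov d * (L : ℝ) ^ 2) ^ 2 * a ^ 2 * ∑ x ∈ box (2 * L) ((L : ℤ) • z), g x := by
    intro z κ
    have hnA : ‖restr (S1 L ((L : ℤ) • z) κ) A‖ ≤ a := (pi_norm_le_iff_of_nonneg ha0).2 fun s => hA _ _
    have h1 := norm_Ccov_le_local_sq hL hV₀ hβ0 hβ hβmax A ha0 hA hac ((L : ℤ) • z) κ
    have h2 : ‖restr (S1 L ((L : ℤ) • z) κ) A‖ ^ 2 ≤ ∑ x ∈ box (2 * L) ((L : ℤ) • z), g x := norm_restr_sq_le_box A z κ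
    have h3 : ‖restr (S1 L ((L : ℤ) • z) κ) A‖ ^ 2 ≤ a ^ 2 := pow_le_pow_left₀ (norm_nonneg _) hnA 2
    have h4 : (‖restr (S1 L ((L : ℤ) • z) κ) A‖ ^ 2) ^ 2 ≤ a ^ 2 * ∑ x ∈ box (2 * L) ((L : ℤ) • z), g x :=
      by rw [sq]; exact mul_le_mul h3 h2 (sq_nonneg _) (sq_nonneg _)
    calc ‖Ccov L V₀ A ((L : ℤ) • z) κ‖ ^ 2 ≤ (C1cov d * (L : ℝ) ^ 2 * ‖restr (S1 L ((L : ℤ) • z) κ) A‖ ^ 2) ^ 2 :=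
          pow_le_pow_left₀ (norm_nonneg _) h1 2
      _ = (C1cov d * (L : ℝ) ^ 2) ^ 2 * (‖restr (S1 L ((L : ℤ) • z) κ) A‖ ^ 2) ^ 2 := by ring
      _ ≤ (C1cov d * (L : ℝ) ^ 2) ^ 2 * (a ^ 2 * ∑ x ∈ box (2 * L) ((L : ℤ) • z), g x) :=
          mul_le_mul_of_nonneg_left h4 (sq_nonneg _)
      _ = _ := by ring
  have hbox := sum_periodBox_box_le L N₁ hL hN₁ (2 * L) hg0 hgP
  have hK : 0 ≤ (C1cov d * (L : ℝ) ^ 2) ^ 2 * a ^ 2 := by positivity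
  calc ∑ z ∈ periodBox (d := d) N₁, ∑ κ : Fin d, ‖Ccov L V₀ A ((L : ℤ) • z) κ‖ ^ 2
      ≤ ∑ z ∈ periodBox (d := d) N₁, ∑ _κ : Fin d, (C1cov d * (L : ℝ) ^ 2) ^ 2 * a ^ 2 * ∑ x ∈ box (2 * L) ((L : ℤ) • z), g x :=
        Finset.sum_le_sum fun z _ => Finset.sum_le_sum fun κ _ => hpt z κ
    _ = (C1cov d * (L : ℝ) ^ 2) ^ 2 * a ^ 2 * (d * ∑ z ∈ periodBox (d := d) N₁, ∑ x ∈ box (2 * L) ((L : ℤ) • z), g x) := by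
        rw [Finset.mul_sum, Finset.mul_sum]
        refine Finset.sum_congr rfl fun z _ => ?_
        rw [Finset.sum_const, Finset.card_univ, Fintype.card_fin, nsmul_eq_mul]
        ring
    _ ≤ (C1cov d * (L : ℝ) ^ 2) ^ 2 * a ^ 2 * (d * ((2 * (2 * L) + 1) ^ d * ∑ x ∈ periodBox (d := d) (L * N₁), g x)) := by
        refine mul_le_mul_of_nonneg_left (mul_le_mul_of_nonneg_left ?_ (by positivity)) hK
        exact_mod_cast hbox
    _ = _ := by ring

end Step

end Summit.QuantumFields.BalabanUV.T4Continuum.NE3.RemainderSumsStepB8
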